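import Literature.NumberTheory.GaloisCohomology.Howard2004.DVRSettingEngineChebProofs
import HarnessLib

/-!
# Howard 2004, H.2 + Lemma 1.6.2 ⟹ `Ш¹(K, T̄) = 0`: a class of `H¹(K, T̄)` vanishing at every place is zero
# (proofs file)

Topic `NumberTheory/GaloisCohomology/Howard2004`. THEOREMS ONLY: no definition, no named fact, no instance, no notation,
no `sorry`.  Cell `pub/bsd-print-x9` (seat x10b-p1-w8 g12, brick «C451-SHA», `--supports stmt-BirchSwinnertonDyer-22642`;
print leaf G87 ↦ the «Flach leaf» C45.1′ / C45.1″).  First step of the COCHAIN-FREE port of Prop. 1.4.1 announced on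
the cell board (2026-08-29T14:1xZ): with `Ш¹(K, T̄) = 0` (this file), `Ш¹(K, T̄*) = 0` (H.4 transport) and the KERNEL
Poitou–Tate (b) one gets `Ш²(K, T̄) = 0`, so that every `𝓕(n)`-Selmer class of `T^{(t)}` lifts to a GLOBAL class of
`T^{(t+1)}` and the left-kernel theory of `TowerSelmerLiftGlobalDualityProofs` / `TowerSelmerLiftPairingWellDefinedProofs`
applies to ALL classes.

SOURCE. B. Howard, *The Heegner point Kolyvagin system*, Compositio Math. **140** (2004) = arXiv:1202.6340: hypothesis H.2
(§1.3, p. 7 L61–63: «`H¹(K(T̄_∞)/K, T̄) = 0` …», the tree's `H2Tower`) and Lemma 1.6.2 (arXiv Lemma 2.6.2, p. 11 L30–58: for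
`c^± ∈ H¹(K, T̄)^±` non-zero there are infinitely many primes `λ` of `𝓛` with `loc_λ c^± ≠ 0`).  The deduction «locally trivial
everywhere ⟹ zero» is the standard use of H.2 + Čebotarev (Mazur–Rubin, *Kolyvagin systems* (2004), Lemma 3.5.2 / proof of
Prop. 3.6.1); here it is READ OFF the tree's `DVRSetting.exists_mem_enginePrimes_localization_ne_zero_single`.

WHAT IS PROVED (a `DVRSetting` `S` with `hy : S.SatisfiesH`, Čebotarev `hC : Automorphic.chebotarev_artinRep` (a kernel
theorem of the tree, taken by name as the engine does), `hp0 : (p : R) ≠ 0`, `hL : S.LargePrimes`; `T̄ = S.ρbar`).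
* §1 `localization_semilinearH_eq_zero_of_eq_zero` — if `loc_{σ v} c = 0` then `loc_v (τ_* c) = 0`
  (`localization_semilinearH`: `loc_v ∘ τ_* = θ_* ∘ transport_v ∘ loc_{σ v}`);
  `localization_eigenparts_eq_zero_of_forall` — the eigen-components `c^± = ½(c ± τ_* c)` of such a `c` vanish at every finite place.
* §2 **`eq_zero_of_forall_localization_inr_eq_zero`** — a class `c ∈ H¹(K, T̄)` with `loc_v c = 0` at every FINITE place is `0`:
  split `c = c⁺ + c⁻` (`ResidualTau.eq_add_of_semilinearH`, `2 ∈ R_0^×`), represent a non-zero `c^±` by an eigencocycle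
  (`exists_eigencocycle_of_semilinearH_eq[_neg]`) and get a prime `v ∈ 𝓛` with `loc_v c^± ≠ 0` from Lemma 1.6.2
  (`exists_mem_enginePrimes_localization_ne_zero_single`) — contradiction.
* **`sha_rhobar_eq_bot`** — hence `Ш¹(K, T̄) = ⊥` (`DiscreteGaloisModule.sha`).

HONEST FRAMING: a consequence of H.0–H.5 + Čebotarev inside Howard's setting; Prop. 1.4.1, C45.1′/C45.1″ and
`thm161_dvrKolyvaginBound` are NOT proved; no summit statement is proved; the Birch–Swinnerton-Dyer conjecture is not proved
by any of this.
-/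

set_option autoImplicit false

noncomputable section

namespace Literature.NumberTheory.GaloisCohomology.Howard2004

open Function NumberField IsDedekindDomain Field
open scoped NumberField ContRepresentation
open Literature.NumberTheory.GaloisRepresentations
open Literature.NumberTheory.GaloisRepresentations.DiscreteGaloisModule
open Literature.NumberTheory.EllipticCurves

namespace DVRSetting

variable {p : ℕ} [Fact p.Prime] {K : Type} [Field K] [NumberField K]
  {R : Type} [CommRing R] [IsDomain R] [IsDiscreteValuationRing R] [Algebra ℤ_[p] R]
  {N : ℕ → Type} [∀ k, AddCommGroup (N k)] [∀ k, TopologicalSpace (N k)]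
  [∀ k, DiscreteTopology (N k)] [∀ k, Module R (N k)]
  {Rk : ℕ → Type} [∀ k, CommRing (Rk k)] [∀ k, IsLocalRing (Rk k)] [∀ k, TopologicalSpace (Rk k)]
  [∀ k, DiscreteTopology (Rk k)] [∀ k, Algebra ℤ_[p] (Rk k)] [∀ k, Algebra R (Rk k)]
  [∀ k, Module (Rk k) (N k)] [∀ k, IsScalarTower R (Rk k) (N k)]
  {Nbar : Type} [AddCommGroup Nbar] [TopologicalSpace Nbar] [DiscreteTopology Nbar]
  [∀ k, Module (Rk k) Nbar]
  {Nq : ℕ → Finset (HeightOneSpectrum (𝓞 K)) → Type} [∀ k n, AddCommGroup (Nq k n)]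
  [∀ k n, TopologicalSpace (Nq k n)] [∀ k n, DiscreteTopology (Nq k n)]
  [∀ k n, Module (Rk k) (Nq k n)] [∀ k n, Module R (Nq k n)]
  [∀ k n, IsScalarTower R (Rk k) (Nq k n)]

/-! ## §1 Local triviality passes to `τ_* c` and to the eigen-components -/

/-- **`loc_v (τ_* c) = 0`** at a finite place `v` as soon as `loc_{σ v} c = 0`: the action of `τ` on `H¹(K, T̄)` localises
to `θ_* ∘ transport_v ∘ loc_{σ v}` (`ResidualTau.localization_semilinearH`).
[cite: Howard2004HeegnerKolyvagin, §1.3 (arXiv:1202.6340 p. 7 L44–48) and H.5 (p. 7 L93–97)] -/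
theorem localization_semilinearH_eq_zero_of_eq_zero (S : DVRSetting p K R N Rk Nbar Nq) (k : ℕ)
    (v : HeightOneSpectrum (𝓞 K)) (c : galoisCohomology S.ρbar 1)
    (hc : galoisCohomology.localization S.ρbar (Sum.inr (S.cd.σ • v)) 1 c = 0) :
    galoisCohomology.localization S.ρbar (Sum.inr v) 1
      (semilinearH S.cd.isLift (S.A k).θ.toAddMonoidHom (S.A k).isSemilinear 1 c) = 0 := by
  rw [(S.A k).localization_semilinearH v c, hc, map_zero, map_zero]

/-- **The eigen-components of an everywhere-locally-trivial class are everywhere locally trivial** (at the finite places):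
for `c⁺ = u·(c + τ_* c)` and `c⁻ = u·(c - τ_* c)` (`u = 2⁻¹ ∈ R_k`).
[cite: Howard2004HeegnerKolyvagin, §1.5 preamble and Lemma 1.6.4 Case i (arXiv:1202.6340 p. 9 L122–126, p. 12 L3–12)] -/
theorem localization_eigenparts_eq_zero_of_forall (S : DVRSetting p K R N Rk Nbar Nq) (hy : S.SatisfiesH) (k : ℕ)
    (u : Rk k) (c : galoisCohomology S.ρbar 1)
    (hc : ∀ w : HeightOneSpectrum (𝓞 K), galoisCohomology.localization S.ρbar (Sum.inr w) 1 c = 0)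
    (v : HeightOneSpectrum (𝓞 K)) :
    galoisCohomology.localization S.ρbar (Sum.inr v) 1
        (galoisCohomology.scalarMapH1 S.ρbar (S.isScalarLinear_rhobar hy k) u
          (c + semilinearH S.cd.isLift (S.A k).θ.toAddMonoidHom (S.A k).isSemilinear 1 c)) = 0 ∧
      galoisCohomology.localization S.ρbar (Sum.inr v) 1
        (galoisCohomology.scalarMapH1 S.ρbar (S.isScalarLinear_rhobar hy k) u
          (c - semilinearH S.cd.isLift (S.A k).θ.toAddMonoidHom (S.A k).isSemilinear 1 c)) = 0 := by
  have hτ := S.localization_semilinearH_eq_zero_of_eq_zero k v c (hc (S.cd.σ • v))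
  constructor
  · rw [galoisCohomology.localization_scalarMapH1, map_add, hc v, hτ, add_zero, map_zero]
  · rw [galoisCohomology.localization_scalarMapH1, map_sub, hc v, hτ, sub_zero, map_zero]

/-! ## §2 `Ш¹(K, T̄) = 0` -/

/-- **A class of `H¹(K, T̄)` trivial at every FINITE place is zero** (H.0–H.5, Čebotarev, `(p : R) ≠ 0`, `𝓛_s ⊆ 𝓛` for
`s ≫ 0`).  Write `c = c⁺ + c⁻` with `τ_* c^± = ±c^±` (`2 ∈ R_0^×`); if `c⁺ ≠ 0`, represent it by a `(+)`-eigencocycle and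
apply Lemma 1.6.2 on the setting: some prime `v ∈ 𝓛` has `loc_v c⁺ ≠ 0`, contradicting §1; likewise for `c⁻`.
[cite: Howard2004HeegnerKolyvagin, H.2 and Lemma 1.6.2 (arXiv:1202.6340 p. 7 L61–63, p. 11 L30–58)]
[cite: MazurRubinMemoirs2004, Lemma 3.5.2 and Prop. 3.6.1 (proof)] -/
theorem eq_zero_of_forall_localization_inr_eq_zero [Finite Nbar] [∀ k, Finite (N k)]
    (S : DVRSetting p K R N Rk Nbar Nq) (hy : S.SatisfiesH) (hC : Automorphic.chebotarev_artinRep)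
    (hp0 : ((p : ℕ) : R) ≠ 0) (hL : S.LargePrimes) (c : galoisCohomology S.ρbar 1)
    (hc : ∀ w : HeightOneSpectrum (𝓞 K), galoisCohomology.localization S.ρbar (Sum.inr w) 1 c = 0) :
    c = 0 := by
  classical
  -- `u = 2⁻¹` in `R_0`
  obtain ⟨w2, hw2⟩ := S.isUnit_two hy 0
  set u : Rk 0 := ((w2⁻¹ : (Rk 0)ˣ) : Rk 0) with hu_def
  have hu : u * 2 = 1 := by rw [hu_def, ← hw2, Units.inv_mul]
  obtain ⟨hsplit, hτp, hτm⟩ :=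
    ResidualTau.eq_add_of_semilinearH (S.A 0) (S.isScalarLinear_rhobar hy 0) u hu c
  set cp := galoisCohomology.scalarMapH1 S.ρbar (S.isScalarLinear_rhobar hy 0) u
      (c + semilinearH S.cd.isLift (S.A 0).θ.toAddMonoidHom (S.A 0).isSemilinear 1 c) with hcp_def
  set cm := galoisCohomology.scalarMapH1 S.ρbar (S.isScalarLinear_rhobar hy 0) u
      (c - semilinearH S.cd.isLift (S.A 0).θ.toAddMonoidHom (S.A 0).isSemilinear 1 c) with hcm_def
  have hloc := S.localization_eigenparts_eq_zero_of_forall hy 0 u c hc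
  -- `c⁺ = 0`
  have hcp : cp = 0 := by
    by_contra hne
    obtain ⟨φ, hφc, hφ⟩ := ResidualTau.exists_eigencocycle_of_semilinearH_eq (S.A 0)
      (S.isScalarLinear_rhobar hy 0) (S.isUnit_two hy 0) cp hτp
    obtain ⟨v, -, -, -, hv, -⟩ := S.exists_mem_enginePrimes_localization_ne_zero_single hy hC hp0 hL 0 ∅ φ
      (ε := (1 : Rk 0)) (Or.inl rfl) (fun g => by rw [one_smul]; exact hφ g) (by rw [hφc]; exact hne)
    rw [hφc] at hv
    exact hv (hloc v).1
  -- `c⁻ = 0`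
  have hcm : cm = 0 := by
    by_contra hne
    obtain ⟨φ, hφc, hφ⟩ := ResidualTau.exists_eigencocycle_of_semilinearH_eq_neg (S.A 0)
      (S.isScalarLinear_rhobar hy 0) (S.isUnit_two hy 0) cm hτm
    obtain ⟨v, -, -, -, hv, -⟩ := S.exists_mem_enginePrimes_localization_ne_zero_single hy hC hp0 hL 0 ∅ φ
      (ε := (-1 : Rk 0)) (Or.inr rfl) (fun g => by rw [neg_one_smul]; exact hφ g) (by rw [hφc]; exact hne)
    rw [hφc] at hv
    exact hv (hloc v).2
  rw [hsplit, hcp, hcm, add_zero]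

/-- **`Ш¹(K, T̄) = 0`** on a `DVRSetting` with H.0–H.5 (+ Čebotarev, `(p : R) ≠ 0`, `𝓛_s ⊆ 𝓛` for `s ≫ 0`): a class of
`H¹(K, T̄)` locally trivial at every place is zero (H.2 + Lemma 1.6.2).
[cite: Howard2004HeegnerKolyvagin, H.2 and Lemma 1.6.2 (arXiv:1202.6340 p. 7 L61–63, p. 11 L30–58)]
[cite: MazurRubinMemoirs2004, Lemma 3.5.2 and Prop. 3.6.1 (proof)] -/
theorem sha_rhobar_eq_bot [Finite Nbar] [∀ k, Finite (N k)]
    (S : DVRSetting p K R N Rk Nbar Nq) (hy : S.SatisfiesH) (hC : Automorphic.chebotarev_artinRep)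
    (hp0 : ((p : ℕ) : R) ≠ 0) (hL : S.LargePrimes) : sha S.ρbar = ⊥ := by
  rw [eq_bot_iff]
  intro c hc
  rw [AddSubgroup.mem_bot]
  exact S.eq_zero_of_forall_localization_inr_eq_zero hy hC hp0 hL c fun w => (mem_sha_iff _ _).1 hc (Sum.inr w)

end DVRSetting

end Literature.NumberTheory.GaloisCohomology.Howard2004

end
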